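import Literature.Computability.Cryptography.PeriodFindingFamily
import Literature.Barriers.QuantumAdvantage.PPolyOraclesThm76
import HarnessLib

/-!
# Aaronson–Chen 2017, Lemma 7.5 (2)–(3): the answer tables of the distinguisher on the oracle `acLang W`

Companion of `PPolyOraclesThm76.lean` towards the discharge of its named fact
`aaronsonChen2017_lem75_quantum` (S. Aaronson, L. Chen, CCC 2017, arXiv:1612.05903, Lemma 7.5
(2)–(3), App. 13 p. 42). The quantum core of the distinguisher
(`Cryptography/PeriodFindingFamily.lean`) queries, at every candidate block length `L`, the
strings `1ⁿ 0 1ʲ 0 x'` — the headers `hdr n j x'` of `UnaryArithMachines.lean` — and its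
read-out law relative to any oracle `A` is governed by the answer tables `Fu (spec P n) A u`.
Relative to the oracle `acLang W` of an assignment of tables `W` (the encoding of Thm. 7.6) these
tables ARE the level-`n` values (`Fu_acLang`: `Fu … u v = levelValue W n (natBits L_u v)`), hence

* injective on `[0, 2^{L_u})` when the level table `W n` is a permutation or when `L_u ≠ ℓ n`
  (the identity is read at the wrong lengths): `Fu_injOn_of_bijective`, `Fu_injOn_of_ne` — the
  case "`f` is a permutation … `A` accepts with probability `0`" of App. 13;
* periodic, `Fu … u v = F n k (natBits (ℓ n) (v mod a))` for `v < 2^{ℓ n}`, with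
  `w ↦ F n k (natBits (ℓ n) w)` injective on `[0, a)`, when `L_u = ℓ n` and `W n` is the
  `PRF^mod` table `modTbl F ℓ n k a` (`Fu_eq_periodic`, `prpTable_injOn`) — the case
  "`f = g_{mod a}` has a unique period `a`" of App. 13.

## References

* [AaronsonChen2017] arXiv:1612.05903, §7.2 (p. 29), Lemma 7.5 (p. 30), App. 13 (p. 42).
* [Kitaev1995] arXiv:quant-ph/9511026, §3–§4 (the experiment served).
-/

noncomputable section

namespace Literature.Barriers.QuantumAdvantage

open _root_.Computability Literature.Computability.Complexity Literature.Computability.Cryptography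
  Literature.Computability.Cryptography.PeriodFinding Finset

variable {ℓ : ℕ → ℕ}

/-! ### Bits -/

/-- The entries of `natBits D v` are the bits of `v` (as `GF2StringArith.getD_natBits`, reproved
to keep the imports light). [folklore] -/
theorem getD_natBits_eq : ∀ (D v i : ℕ), (natBits D v).getD i false = (decide (i < D) && v.testBit i)
  | 0, v, i => by simp [natBits]
  | D + 1, v, 0 => by simp [natBits, Nat.testBit_zero]
  | D + 1, v, i + 1 => by
    rw [natBits, List.getD_cons_succ, getD_natBits_eq D (v / 2) i, Nat.testBit_succ]
    simp

/-- The block reads its offset in the format `natBits`. [folklore] -/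
theorem ofFn_testBit_eq_natBits (L v : ℕ) : (List.ofFn fun i : Fin L => v.testBit i) = natBits L v := by
  apply List.ext_getElem (by simp)
  intro i h1 h2
  have hi : i < L := by simpa using h1
  have := getD_natBits_eq L v i
  rw [List.getD_eq_getElem?_getD, List.getElem?_eq_getElem h2, Option.getD_some] at this
  rw [this]
  simp [hi]

/-- `natBits L` is injective on `[0, 2^L)`. [folklore] -/
theorem natBits_injOn (L : ℕ) : Set.InjOn (natBits L) (Set.Iio (2 ^ L)) := fun v hv v' hv' h => by
  rw [← bitsToNat_natBits (D := L) hv, ← bitsToNat_natBits (D := L) hv', h]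

/-! ### The level values -/

/-- The level value has the length of its argument. [folklore] -/
theorem length_levelValue (W : Tables ℓ) (m : ℕ) (x : List Bool) : (levelValue W m x).length = x.length := by
  unfold levelValue
  split_ifs with h
  · rw [List.Vector.toList_length, h]
  · rfl

/-- The oracle answer to a header is the corresponding bit of the level value. [cite: AaronsonChen2017, Thm. 7.6 (proof, p. 30)] -/
theorem boolIndicator_hdr (W : Tables ℓ) (m j : ℕ) (x : List Bool) :
    (acLang W).boolIndicator (hdr m j x) = (levelValue W m x).getD j false := by
  have h := hdr_mem_acLang W m j x
  cases hb : (levelValue W m x).getD j false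
  · exact (Set.notMem_iff_boolIndicator _ _).1 fun hm => by
      have := h.1 hm
      rw [hb] at this
      exact Bool.false_ne_true this
  · exact (Set.mem_iff_boolIndicator _ _).1 (h.2 hb)

variable (P : FParams) (W : Tables ℓ) (n : ℕ)

/-- **The answer tables on `acLang W` are the level-`n` values.** [cite: AaronsonChen2017, Thm. 7.6 (proof, p. 30)] -/
theorem Fu_acLang (u : Fin (nU P n)) (v : ℕ) :
    Fu (spec P n) (acLang W) u v = levelValue W n (natBits (Lof P n u) v) := by
  unfold Fu
  rw [ofFn_testBit_eq_natBits]
  have hL : (spec P n).L u = Lof P n u := rfl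
  apply List.ext_getElem (by rw [List.length_ofFn, length_levelValue, length_natBits])
  intro j h1 h2
  rw [List.getElem_ofFn]
  have hj : j < Lof P n u := by simpa using h1
  show (acLang W).boolIndicator (cpre P n j ++ natBits (Lof P n u) v) = _
  rw [cpre_append P n (hj.trans (Lof_lt_Ltop P n u)), boolIndicator_hdr, List.getD_eq_getElem?_getD,
    List.getElem?_eq_getElem h2, Option.getD_some]

/-- **At a wrong length the table is injective** (the identity is read). [cite: AaronsonChen2017, App. 13 (proof of Lemma 7.5 (3))] -/
theorem Fu_injOn_of_ne (u : Fin (nU P n)) (h : Lof P n u ≠ ℓ n) :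
    Set.InjOn (Fu (spec P n) (acLang W) u) (range (Qof (spec P n).L u) : Set ℕ) := by
  intro v hv v' hv' e
  rw [Fu_acLang, Fu_acLang, levelValue, levelValue, dif_neg (by rw [length_natBits]; exact h),
    dif_neg (by rw [length_natBits]; exact h)] at e
  exact natBits_injOn _ (mem_range.1 (mem_coe.1 hv)) (mem_range.1 (mem_coe.1 hv')) e

/-- **On a permutation level read at its own length the table is injective** ("`f` is a
permutation"). [cite: AaronsonChen2017, App. 13 (proof of Lemma 7.5 (3))] -/
theorem Fu_injOn_of_bijective (u : Fin (nU P n)) (h : Lof P n u = ℓ n) (hW : Function.Bijective (W n)) :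
    Set.InjOn (Fu (spec P n) (acLang W) u) (range (Qof (spec P n).L u) : Set ℕ) := by
  intro v hv v' hv' e
  have hlen : ∀ w, (natBits (Lof P n u) w).length = ℓ n := fun w => by rw [length_natBits, h]
  rw [Fu_acLang, Fu_acLang, levelValue, levelValue, dif_pos (hlen v), dif_pos (hlen v')] at e
  have e' : (⟨natBits (Lof P n u) v, hlen v⟩ : List.Vector Bool (ℓ n)) = ⟨natBits (Lof P n u) v', hlen v'⟩ :=
    hW.1 (List.Vector.toList_injective e)
  have e'' : natBits (Lof P n u) v = natBits (Lof P n u) v' := congrArg List.Vector.toList e'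
  exact natBits_injOn _ (mem_range.1 (mem_coe.1 hv)) (mem_range.1 (mem_coe.1 hv')) e''

/-- The `PRP^raw` table composed with `natBits` is injective on `[0, a)` for a modulus `a ∈ A`.
[cite: AaronsonChen2017, Def. 7.1 and §7.2] -/
theorem prpTable_injOn {F : FunctionEnsemble} {κ : ℕ → ℕ} (hF : IsPRP F κ ℓ) {k : List Bool}
    (hk : k.length = κ n) {a : ℕ} (ha : a ∈ zhandryModuli (2 ^ ℓ n)) :
    Set.InjOn (fun w => F n k (natBits (ℓ n) w)) (range a : Set ℕ) := by
  intro w hw w' hw' e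
  have haN := le_of_mem_zhandryModuli ha
  have hwN : w < 2 ^ ℓ n := lt_of_lt_of_le (mem_range.1 (mem_coe.1 hw)) haN
  have hw'N : w' < 2 ^ ℓ n := lt_of_lt_of_le (mem_range.1 (mem_coe.1 hw')) haN
  have e' := hF.injOn n hk (by simp) (by simp) e
  exact natBits_injOn _ hwN hw'N e'

/-- **On a `PRF^mod` level read at its own length the table is periodic**: for `v < 2^{ℓ n}`,
`Fu … u v = F n k (natBits (ℓ n) (v mod a))` ("`f = g_{mod a}`").
[cite: AaronsonChen2017, App. 13 (proof of Lemma 7.5 (2))] -/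
theorem Fu_eq_periodic {F : FunctionEnsemble} {κ : ℕ → ℕ} (hF : IsPRP F κ ℓ) (u : Fin (nU P n))
    (h : Lof P n u = ℓ n) {k : List Bool} (hk : k.length = κ n) (a : ℕ) (hW : W n = modTbl F ℓ n k a)
    (v : ℕ) (hv : v < Qof (spec P n).L u) :
    Fu (spec P n) (acLang W) u v = F n k (natBits (ℓ n) (v % a)) := by
  have hlen : (natBits (Lof P n u) v).length = ℓ n := by rw [length_natBits, h]
  rw [Fu_acLang, levelValue, dif_pos hlen, hW]
  have hval : ∀ x : List.Vector Bool (ℓ n), (modTbl F ℓ n k a x).toList = prfMod F ℓ n k a x.toList := by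
    intro x
    have hl : (prfMod F ℓ n k a x.toList).length = ℓ n := length_prfMod hF.isEfficientFamily n hk a x.toList
    simp [modTbl, toTbl, hl]
  rw [hval, List.Vector.toList_mk, prfMod_apply, modReduce, h, bitsToNat_natBits]
  have hv' : v < 2 ^ Lof P n u := hv
  rwa [h] at hv'

end Literature.Barriers.QuantumAdvantage

end
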